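import Summits.CriticalPhenomena.PercolationContinuityZ3.Theorems.PercNearOneGluingNoHeavyLowerTailKNGoodThreeRelaysKN
import Literature.Probability.Percolation.KozmaNitzanGoodQuadruple
import HarnessLib

/-!
# `NoHeavyLowerTail` (stmt-CriticalPhenomena-4575) — STRONG GOODNESS FOR THREE RELAYS UNDER KOZMA–NITZAN'S THEOREM-2 HYPOTHESIS

Support file (`--supports stmt-CriticalPhenomena-4575`, hull-port prover `prim-hp-2`, gen 23).  No new definitions, no named facts,
no sorries; standard axioms.

Kozma–Nitzan (arXiv:2401.12397) prove their pre-FKG inequality (3) for `|A| = 3` under the hypothesis of their Theorem 2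
(`m_j ≤ m_{A∖j}` for some `j`; for the least reliable relay `c` it reads `m_c ≤ m_{A∖c}`, p. 8 (7)).  The pocket lift
(`KNGoodThreeKN.core`) gives MORE under the same hypothesis: the quadruple is (strongly) GOOD in the sense of their §3.2 —
for EVERY finite weighted graph, with no separation hypothesis and no restriction on the observer.

* `KNGoodThreeKN.strongGood_triple_of_KN` — `c, a, t` relays with `P(c↔b) ≤ P(a↔b), P(t↔b)` and `m_c ≤ m_{at}`:
  `min_x P(x↔b) − Σ_{W∩A=∅} P(C(o)=W)·min_x P_{G∖W}(x↔b) ≤ P(o↔b, o↔A)`  (`A = {c,a,t}`).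
* `KNGoodThreeKN.knGood_triple_of_KN` — hence `KNGood w {c,a,t} _ o b`.
Proof: the three-relay pocket algebra (designee classes `𝒬_a = {W : P_a(W) < P_c(W), P_a(W) ≤ P_t(W)}`,
`𝒬_t = {W : P_t(W) < P_c(W), P_t(W) < P_a(W)}`, as in `KNGoodTwoRelaysStrong`) reduces the claim to `KNGoodThreeKN.core`.
[cite: KozmaNitzan2024, §3.2 Definition (p. 12), Thm. 2 (p. 8), inequalities (2)–(3) (p. 3)]
[cite: VandenbergHaggstromKahn2005, Thm. 1.1 (pp. 3–5)]
-/

noncomputable section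

namespace Summit.CriticalPhenomena.PercolationContinuityZ3.Theorems

open MeasureTheory Set Literature.Probability.LatticeModels Literature.Probability.Percolation
open scoped Classical

namespace KNGoodThreeKN

open KNGoodAux KNGoodPocketBHK

variable {V : Type*} [Fintype V]

/-- **Strong goodness for three relays under Kozma–Nitzan's Theorem-2 hypothesis.**  For ANY finite weighted graph,
observer `o`, target `b` and relays `c, a, t` with `P(c↔b) ≤ P(a↔b)`, `P(c↔b) ≤ P(t↔b)` and
`m_c ≤ m_{at}` (`P(c↔b, a↮b, t↮b) ≤ P(a↔b, t↔b, c↮b)`):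
`min_x P(x↔b) − Σ_{W ∩ A = ∅} P(C(o)=W)·min_x P_{G∖W}(x↔b) ≤ P(o↔b, o↔A)`, `A = {c,a,t}`.
[cite: KozmaNitzan2024, §3.2 Definition (p. 12), Thm. 2 (p. 8)] -/
theorem strongGood_triple_of_KN (w : Sym2 V → unitInterval) (o b c a t : V)
    (hca : (prodBernoulli w).real (openConn c b) ≤ (prodBernoulli w).real (openConn a b))
    (hct : (prodBernoulli w).real (openConn c b) ≤ (prodBernoulli w).real (openConn t b))
    (hKN : (prodBernoulli w).real (openConn c b ∩ (openConn a b)ᶜ ∩ (openConn t b)ᶜ) ≤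
      (prodBernoulli w).real (openConn a b ∩ openConn t b ∩ (openConn c b)ᶜ)) :
    ({c, a, t} : Finset V).inf' (Finset.insert_nonempty c {a, t}) (fun x => (prodBernoulli w).real (openConn x b)) -
        ∑ W ∈ nullSets ({c, a, t} : Finset V), (prodBernoulli w).real (clusterIs o W) *
          ({c, a, t} : Finset V).inf' (Finset.insert_nonempty c {a, t})
            (fun x => (prodBernoulli w).real (openConnIn ((↑W : Set V)ᶜ) x b)) ≤
      (prodBernoulli w).real (openConn o b ∩ (openConn o c ∪ openConn o a ∪ openConn o t)) := by
  classical
  set μ := prodBernoulli w with hμ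
  haveI : IsProbabilityMeasure μ := by rw [hμ]; infer_instance
  have hmeas : ∀ S : Set (BondConfig V), MeasurableSet S := fun _ => MeasurableSet.of_discrete
  have hAne : ({c, a, t} : Finset V).Nonempty := Finset.insert_nonempty c {a, t}
  have hnull : ∀ W ∈ nullSets ({c, a, t} : Finset V), c ∉ W ∧ a ∉ W ∧ t ∉ W := by
    intro W hW
    have hd := mem_nullSets.1 hW
    exact ⟨fun h => Finset.disjoint_left.1 hd h (by simp), fun h => Finset.disjoint_left.1 hd h (by simp),
      fun h => Finset.disjoint_left.1 hd h (by simp)⟩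
  set Pc : Finset V → ℝ := fun W => μ.real (clusterIs o W ∩ openConn c b) with hPc
  set Pa : Finset V → ℝ := fun W => μ.real (clusterIs o W ∩ openConn a b) with hPa
  set Pt : Finset V → ℝ := fun W => μ.real (clusterIs o W ∩ openConn t b) with hPt
  -- Step A
  have stepA : ({c, a, t} : Finset V).inf' hAne (fun x => μ.real (openConn x b)) ≤ μ.real (openConn c b) :=
    Finset.inf'_le _ (by simp)
  -- Step B: pocket by pocket
  have stepB : ∀ W ∈ nullSets ({c, a, t} : Finset V),
      Pc W - max (max (Pc W - Pa W) (Pc W - Pt W)) 0 ≤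
        μ.real (clusterIs o W) * ({c, a, t} : Finset V).inf' hAne (fun x => μ.real (openConnIn ((↑W : Set V)ᶜ) x b)) := by
    intro W hW
    obtain ⟨hcW, haW, htW⟩ := hnull W hW
    have ec : Pc W = μ.real (clusterIs o W) * μ.real (openConnIn ((↑W : Set V)ᶜ) c b) :=
      real_clusterIs_inter_openConn w o W hcW b
    have ea : Pa W = μ.real (clusterIs o W) * μ.real (openConnIn ((↑W : Set V)ᶜ) a b) :=
      real_clusterIs_inter_openConn w o W haW b
    have et : Pt W = μ.real (clusterIs o W) * μ.real (openConnIn ((↑W : Set V)ᶜ) t b) :=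
      real_clusterIs_inter_openConn w o W htW b
    have hinf : ({c, a, t} : Finset V).inf' hAne (fun x => μ.real (openConnIn ((↑W : Set V)ᶜ) x b)) =
        μ.real (openConnIn ((↑W : Set V)ᶜ) c b) ⊓ (μ.real (openConnIn ((↑W : Set V)ᶜ) a b) ⊓
          μ.real (openConnIn ((↑W : Set V)ᶜ) t b)) := by
      rw [Finset.inf'_insert, Finset.inf'_insert, Finset.inf'_singleton]
      all_goals first | exact Finset.singleton_nonempty _ | exact Finset.insert_nonempty _ _
    rw [hinf]
    have h0 : 0 ≤ μ.real (clusterIs o W) := measureReal_nonneg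
    have hm1 := le_max_right (max (Pc W - Pa W) (Pc W - Pt W)) 0
    have hm2 : Pc W - Pa W ≤ max (max (Pc W - Pa W) (Pc W - Pt W)) 0 := (le_max_left _ _).trans (le_max_left _ _)
    have hm3 : Pc W - Pt W ≤ max (max (Pc W - Pa W) (Pc W - Pt W)) 0 := (le_max_right _ _).trans (le_max_left _ _)
    rcases le_total (μ.real (openConnIn ((↑W : Set V)ᶜ) c b))
      (μ.real (openConnIn ((↑W : Set V)ᶜ) a b) ⊓ μ.real (openConnIn ((↑W : Set V)ᶜ) t b)) with h | h
    · rw [inf_eq_left.2 h, ← ec]; linarith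
    · rw [inf_eq_right.2 h]
      rcases le_total (μ.real (openConnIn ((↑W : Set V)ᶜ) a b)) (μ.real (openConnIn ((↑W : Set V)ᶜ) t b)) with h' | h'
      · rw [inf_eq_left.2 h', ← ea]; linarith
      · rw [inf_eq_right.2 h', ← et]; linarith
  have stepB' : ∑ W ∈ nullSets ({c, a, t} : Finset V), Pc W -
      ∑ W ∈ nullSets ({c, a, t} : Finset V), max (max (Pc W - Pa W) (Pc W - Pt W)) 0 ≤
      ∑ W ∈ nullSets ({c, a, t} : Finset V), μ.real (clusterIs o W) *
        ({c, a, t} : Finset V).inf' hAne (fun x => μ.real (openConnIn ((↑W : Set V)ᶜ) x b)) := by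
    rw [← Finset.sum_sub_distrib]; exact Finset.sum_le_sum stepB
  set NA : Set (BondConfig V) := {ω | ∀ x ∈ ({c, a, t} : Finset V), ¬ (openGraph ω).Reachable o x} with hNA
  have sumPc : ∑ W ∈ nullSets ({c, a, t} : Finset V), Pc W = μ.real (NA ∩ openConn c b) :=
    sum_real_clusterIs_inter w {c, a, t} o _
  -- Step C: designee classes
  set Pka : Finset (Finset V) := (nullSets ({c, a, t} : Finset V)).filter fun W => Pa W < Pc W ∧ Pa W ≤ Pt W with hPka
  set Pkt : Finset (Finset V) := (nullSets ({c, a, t} : Finset V)).filter fun W => Pt W < Pc W ∧ Pt W < Pa W with hPkt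
  have hPkasub : Pka ⊆ nullSets ({c, a, t} : Finset V) := Finset.filter_subset _ _
  have hPktsub : Pkt ⊆ nullSets ({c, a, t} : Finset V) := Finset.filter_subset _ _
  have stepC : ∑ W ∈ nullSets ({c, a, t} : Finset V), max (max (Pc W - Pa W) (Pc W - Pt W)) 0 =
      (∑ W ∈ Pka, Pc W - ∑ W ∈ Pka, Pa W) + (∑ W ∈ Pkt, Pc W - ∑ W ∈ Pkt, Pt W) := by
    rw [← Finset.sum_sub_distrib, ← Finset.sum_sub_distrib]
    have key : ∀ W ∈ nullSets ({c, a, t} : Finset V), max (max (Pc W - Pa W) (Pc W - Pt W)) 0 =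
        (if Pa W < Pc W ∧ Pa W ≤ Pt W then Pc W - Pa W else 0) + (if Pt W < Pc W ∧ Pt W < Pa W then Pc W - Pt W else 0) := by
      intro W _
      by_cases h1 : Pa W < Pc W ∧ Pa W ≤ Pt W
      · have h2 : ¬ (Pt W < Pc W ∧ Pt W < Pa W) := fun h => absurd h1.2 (not_le.2 h.2)
        rw [if_pos h1, if_neg h2, add_zero]
        rw [max_eq_left ((le_max_left _ _).trans' (by linarith [h1.1] : (0:ℝ) ≤ Pc W - Pa W)), max_eq_left (by linarith [h1.2])]
      · rw [if_neg h1, zero_add]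
        by_cases h2 : Pt W < Pc W ∧ Pt W < Pa W
        · rw [if_pos h2]
          rw [max_eq_left ((le_max_right _ _).trans' (by linarith [h2.1] : (0:ℝ) ≤ Pc W - Pt W)), max_eq_right (by linarith [h2.2])]
        · rw [if_neg h2]
          apply max_eq_right
          rcases le_or_gt (Pa W) (Pt W) with h3 | h3
          · have h4 : Pc W ≤ Pa W := not_lt.1 (fun h => h1 ⟨h, h3⟩)
            exact max_le (by linarith) (by linarith)
          · have h4 : Pc W ≤ Pt W := not_lt.1 (fun h => h2 ⟨h, h3⟩)
            exact max_le (by linarith) (by linarith)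
    rw [Finset.sum_congr rfl key, Finset.sum_add_distrib, Finset.sum_ite, Finset.sum_ite, Finset.sum_const_zero,
      Finset.sum_const_zero, add_zero, add_zero]
  -- the pockets of each class
  set Poca : Set (BondConfig V) := ⋃ W ∈ Pka, clusterIs o W with hPoca
  set Poct : Set (BondConfig V) := ⋃ W ∈ Pkt, clusterIs o W with hPoct
  have sumP : ∀ (Pk : Finset (Finset V)) (E : Set (BondConfig V)),
      ∑ W ∈ Pk, μ.real (clusterIs o W ∩ E) = μ.real ((⋃ W ∈ Pk, clusterIs o W) ∩ E) := by
    intro Pk E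
    have hdisj : Set.PairwiseDisjoint (↑Pk : Set (Finset V)) fun W => clusterIs o W ∩ E := by
      intro W _ W' _ hne
      exact (pairwise_disjoint_clusterIs o hne).mono inter_subset_left inter_subset_left
    rw [← measureReal_biUnion_finset hdisj fun W _ => hmeas _, Set.iUnion₂_inter]
  set Qa : Set (Set V) := {S | ∃ W ∈ Pka, (↑W : Set V) = S} with hQa
  set Qt : Set (Set V) := {S | ∃ W ∈ Pkt, (↑W : Set V) = S} with hQt
  have hQa3 : ∀ S ∈ Qa, a ∉ S ∧ t ∉ S ∧ c ∉ S := by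
    rintro S ⟨W, hW, rfl⟩
    obtain ⟨hcW, haW, htW⟩ := hnull W (hPkasub hW)
    exact ⟨fun h => haW (Finset.mem_coe.1 h), fun h => htW (Finset.mem_coe.1 h), fun h => hcW (Finset.mem_coe.1 h)⟩
  have hQt3 : ∀ S ∈ Qt, a ∉ S ∧ t ∉ S ∧ c ∉ S := by
    rintro S ⟨W, hW, rfl⟩
    obtain ⟨hcW, haW, htW⟩ := hnull W (hPktsub hW)
    exact ⟨fun h => haW (Finset.mem_coe.1 h), fun h => htW (Finset.mem_coe.1 h), fun h => hcW (Finset.mem_coe.1 h)⟩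
  have hdisQ : Disjoint Qa Qt := by
    rw [Set.disjoint_left]
    rintro S ⟨W, hW, rfl⟩ ⟨W', hW', hWW'⟩
    have : W' = W := Finset.coe_injective hWW'
    subst this
    have h1 := (Finset.mem_filter.1 hW).2.2
    have h2 := (Finset.mem_filter.1 hW').2.2
    exact absurd h1 (not_le.2 h2)
  have memPoca : ∀ ω, ω ∈ Poca ↔ openCluster ω o ∈ Qa := by
    intro ω
    simp only [hPoca, hQa, Set.mem_iUnion, Set.mem_setOf_eq, mem_clusterIs, exists_prop]
    constructor
    · rintro ⟨W, hW, h⟩; exact ⟨W, hW, h.symm⟩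
    · rintro ⟨W, hW, h⟩; exact ⟨W, hW, h.symm⟩
  have memPoct : ∀ ω, ω ∈ Poct ↔ openCluster ω o ∈ Qt := by
    intro ω
    simp only [hPoct, hQt, Set.mem_iUnion, Set.mem_setOf_eq, mem_clusterIs, exists_prop]
    constructor
    · rintro ⟨W, hW, h⟩; exact ⟨W, hW, h.symm⟩
    · rintro ⟨W, hW, h⟩; exact ⟨W, hW, h.symm⟩
  have hPoca_pk : Poca = pk o Qa := by ext ω; rw [memPoca]; rfl
  have hPoct_pk : Poct = pk o Qt := by ext ω; rw [memPoct]; rfl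
  -- the event-level theorem
  have hcore := core w o b a t c Qa Qt hQa3 hQt3 hdisQ hca hct hKN
  rw [← hμ, ← hPoca_pk, ← hPoct_pk] at hcore
  -- pocket differences as differences on E_c / E_x
  have dif : ∀ (P : Set (BondConfig V)) (x : V),
      μ.real (P ∩ openConn c b) - μ.real (P ∩ openConn x b) =
        μ.real (P ∩ (openConn c b ∩ (openConn x b)ᶜ)) - μ.real (P ∩ (openConn x b ∩ (openConn c b)ᶜ)) := by
    intro P x
    have e1 : μ.real ((P ∩ openConn c b) ∩ openConn x b) + μ.real ((P ∩ openConn c b) \ openConn x b) =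
        μ.real (P ∩ openConn c b) := measureReal_inter_add_sdiff (hmeas _)
    have e2 : μ.real ((P ∩ openConn x b) ∩ openConn c b) + μ.real ((P ∩ openConn x b) \ openConn c b) =
        μ.real (P ∩ openConn x b) := measureReal_inter_add_sdiff (hmeas _)
    have e3 : (P ∩ openConn c b) ∩ openConn x b = (P ∩ openConn x b) ∩ openConn c b := by
      rw [Set.inter_assoc, Set.inter_assoc, Set.inter_comm (openConn c b)]
    have e4 : (P ∩ openConn c b) \ openConn x b = P ∩ (openConn c b ∩ (openConn x b)ᶜ) := by
      ext ω; simp only [Set.mem_sdiff, Set.mem_inter_iff, Set.mem_compl_iff]; tauto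
    have e5 : (P ∩ openConn x b) \ openConn c b = P ∩ (openConn x b ∩ (openConn c b)ᶜ) := by
      ext ω; simp only [Set.mem_sdiff, Set.mem_inter_iff, Set.mem_compl_iff]; tauto
    rw [e3] at e1; rw [e4] at e1; rw [e5] at e2
    linarith
  have difa := dif Poca a
  have dift := dif Poct t
  -- the designated part: `μ(c↔b ∖ NA) = μ(o↔b, o↔c) + μ(c↔b, o↮b, o↔{a,t})`
  have d0 : μ.real (openConn c b ∩ NA) + μ.real (openConn c b \ NA) = μ.real (openConn c b) :=
    measureReal_inter_add_sdiff (hmeas _)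
  set G₁ : Set (BondConfig V) := {ω | (openGraph ω).Reachable o b ∧ (openGraph ω).Reachable o c} with hG₁
  have d1 : μ.real (openConn c b \ NA) ≤
      μ.real G₁ + μ.real (openConn c b ∩ (openConn o b)ᶜ ∩ (openConn o a ∪ openConn o t)) := by
    refine (measureReal_mono (fun ω hω => ?_)).trans (measureReal_union_le G₁ _)
    obtain ⟨hcb, hNAω⟩ := hω
    simp only [hNA, Set.mem_setOf_eq, not_forall, not_not, exists_prop] at hNAω
    obtain ⟨x, hxA, hox⟩ := hNAω
    simp only [Finset.mem_insert, Finset.mem_singleton] at hxA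
    simp only [hG₁, openConn, Set.mem_union, Set.mem_inter_iff, Set.mem_compl_iff, Set.mem_setOf_eq]
    simp only [openConn, Set.mem_setOf_eq] at hcb
    by_cases hob : (openGraph ω).Reachable o b
    · exact Or.inl ⟨hob, hob.trans hcb.symm⟩
    · rcases hxA with rfl | rfl | rfl
      · exact absurd (hox.trans hcb) hob
      · exact Or.inr ⟨⟨hcb, hob⟩, Or.inl hox⟩
      · exact Or.inr ⟨⟨hcb, hob⟩, Or.inr hox⟩
  have d2 : μ.real G₁ + μ.real (openConn o b ∩ (openConn c b)ᶜ ∩ (openConn o a ∪ openConn o t)) ≤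
      μ.real (openConn o b ∩ (openConn o c ∪ openConn o a ∪ openConn o t)) := by
    have hd : Disjoint G₁ (openConn o b ∩ (openConn c b)ᶜ ∩ (openConn o a ∪ openConn o t)) := by
      rw [Set.disjoint_left]
      rintro ω ⟨hob, hoc⟩ ⟨⟨-, hcb⟩, -⟩
      exact hcb (hoc.symm.trans hob)
    rw [← measureReal_union hd (hmeas _)]
    refine measureReal_mono (fun ω hω => ?_)
    simp only [openConn, Set.mem_inter_iff, Set.mem_union, Set.mem_compl_iff, Set.mem_setOf_eq, hG₁] at hω ⊢
    rcases hω with ⟨hob, hoc⟩ | ⟨⟨hob, -⟩, hoa | hot⟩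
    · exact ⟨hob, Or.inl (Or.inl hoc)⟩
    · exact ⟨hob, Or.inl (Or.inr hoa)⟩
    · exact ⟨hob, Or.inr hot⟩
  -- assemble
  have sPca := sumP Pka (openConn c b)
  have sPaa := sumP Pka (openConn a b)
  have sPct := sumP Pkt (openConn c b)
  have sPtt := sumP Pkt (openConn t b)
  rw [Set.inter_comm] at sumPc
  have hsum := stepB'
  rw [stepC, sumPc, sPca, sPaa, sPct, sPtt] at hsum
  linarith [hsum, stepA, d0, d1, d2, hcore, difa, dift]

/-- **Kozma–Nitzan goodness for three relays under their Theorem-2 hypothesis**: with `c` the least reliable relay and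
`m_c ≤ m_{at}`, the quadruple `(G, {c,a,t}, o, b)` is good — for EVERY finite weighted graph and every observer.
[cite: KozmaNitzan2024, §3.2 Definition (p. 12), Thm. 2 (p. 8)] -/
theorem knGood_triple_of_KN (w : Sym2 V → unitInterval) (o b c a t : V)
    (hca : (prodBernoulli w).real (openConn c b) ≤ (prodBernoulli w).real (openConn a b))
    (hct : (prodBernoulli w).real (openConn c b) ≤ (prodBernoulli w).real (openConn t b))
    (hKN : (prodBernoulli w).real (openConn c b ∩ (openConn a b)ᶜ ∩ (openConn t b)ᶜ) ≤
      (prodBernoulli w).real (openConn a b ∩ openConn t b ∩ (openConn c b)ᶜ)) :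
    KNGood w ({c, a, t} : Finset V) (Finset.insert_nonempty c {a, t}) o b := by
  have h := strongGood_triple_of_KN w o b c a t hca hct hKN
  have hmono : (prodBernoulli w).real (openConn o b ∩ (openConn o c ∪ openConn o a ∪ openConn o t)) ≤
      (prodBernoulli w).real (openConn o b) := measureReal_mono inter_subset_left
  unfold KNGood
  linarith

/-- **Kozma–Nitzan's Theorem-2 hypothesis, any `j`, gives goodness.**  With `c` the least reliable of the relays `c, a, t` and
`m_S := P(b ↔ x ∀ x ∈ S, b ↮ A∖S)`: if `m_c ≤ m_{at}` or `m_a ≤ m_{tc}` or `m_t ≤ m_{ac}` then `(G, {c,a,t}, o, b)` is good.  (KN p. 8,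
(7): each alternative implies `m_c ≤ m_{at}`.) [cite: KozmaNitzan2024, Thm. 2 and (7) (p. 8), §3.2 Definition (p. 12)] -/
theorem knGood_triple_of_KN' (w : Sym2 V → unitInterval) (o b c a t : V)
    (hca : (prodBernoulli w).real (openConn c b) ≤ (prodBernoulli w).real (openConn a b))
    (hct : (prodBernoulli w).real (openConn c b) ≤ (prodBernoulli w).real (openConn t b))
    (hj : (prodBernoulli w).real (openConn c b ∩ (openConn a b)ᶜ ∩ (openConn t b)ᶜ) ≤
        (prodBernoulli w).real (openConn a b ∩ openConn t b ∩ (openConn c b)ᶜ) ∨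
      (prodBernoulli w).real (openConn a b ∩ (openConn t b)ᶜ ∩ (openConn c b)ᶜ) ≤
        (prodBernoulli w).real (openConn t b ∩ openConn c b ∩ (openConn a b)ᶜ) ∨
      (prodBernoulli w).real (openConn t b ∩ (openConn a b)ᶜ ∩ (openConn c b)ᶜ) ≤
        (prodBernoulli w).real (openConn a b ∩ openConn c b ∩ (openConn t b)ᶜ)) :
    KNGood w ({c, a, t} : Finset V) (Finset.insert_nonempty c {a, t}) o b := by
  classical
  apply knGood_triple_of_KN w o b c a t hca hct
  rcases hj with h | h | h
  · exact h
  · -- `m_a ≤ m_{tc}`: `P(ab) − P(cb) = (m_a + m_{at}) − (m_c + m_{tc}) ≥ 0`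
    have Ma := real_cb_split_a w a t c b
    have Mb := real_ab_split w a t c b
    have e1 : openConn a b ∩ avoidSet ({a} : Set V) {t, c} = openConn a b ∩ (openConn t b)ᶜ ∩ (openConn c b)ᶜ := by
      ext ω
      simp only [Set.mem_inter_iff, Set.mem_compl_iff, mem_avoidSet_one_two, openConn, Set.mem_setOf_eq]
      constructor
      · rintro ⟨hab, hat, hac⟩
        exact ⟨⟨hab, fun htb => hat (hab.trans htb.symm)⟩, fun hcb => hac (hab.trans hcb.symm)⟩
      · rintro ⟨⟨hab, htb⟩, hcb⟩
        exact ⟨hab, fun hat => htb (hat.symm.trans hab), fun hac => hcb (hac.symm.trans hab)⟩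
    have e2 : openConn t c ∩ openConn t b ∩ avoidSet ({a} : Set V) {t, c} =
        openConn t b ∩ openConn c b ∩ (openConn a b)ᶜ := by
      ext ω
      simp only [Set.mem_inter_iff, Set.mem_compl_iff, mem_avoidSet_one_two, openConn, Set.mem_setOf_eq]
      constructor
      · rintro ⟨⟨htc, htb⟩, hat, -⟩
        exact ⟨⟨htb, htc.symm.trans htb⟩, fun hab => hat (hab.trans htb.symm)⟩
      · rintro ⟨⟨htb, hcb⟩, hab⟩
        exact ⟨⟨htb.trans hcb.symm, htb⟩, fun hat => hab (hat.trans htb), fun hac => hab (hac.trans hcb)⟩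
    rw [e1] at Mb
    rw [e2] at Ma
    rw [mc_set_eq w a t c b, mK_set_eq w a t c b]
    linarith
  · have Mc := real_cb_split_t w a t c b
    have Md := real_tb_split w a t c b
    have e1 : openConn t b ∩ avoidSet ({t} : Set V) {a, c} = openConn t b ∩ (openConn a b)ᶜ ∩ (openConn c b)ᶜ := by
      ext ω
      simp only [Set.mem_inter_iff, Set.mem_compl_iff, mem_avoidSet_one_two, openConn, Set.mem_setOf_eq]
      constructor
      · rintro ⟨htb, hta, htc⟩
        exact ⟨⟨htb, fun hab => hta (htb.trans hab.symm)⟩, fun hcb => htc (htb.trans hcb.symm)⟩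
      · rintro ⟨⟨htb, hab⟩, hcb⟩
        exact ⟨htb, fun hta => hab (hta.symm.trans htb), fun htc => hcb (htc.symm.trans htb)⟩
    have e2 : openConn a c ∩ openConn a b ∩ avoidSet ({t} : Set V) {a, c} =
        openConn a b ∩ openConn c b ∩ (openConn t b)ᶜ := by
      ext ω
      simp only [Set.mem_inter_iff, Set.mem_compl_iff, mem_avoidSet_one_two, openConn, Set.mem_setOf_eq]
      constructor
      · rintro ⟨⟨hac, hab⟩, hta, -⟩
        exact ⟨⟨hab, hac.symm.trans hab⟩, fun htb => hta (htb.trans hab.symm)⟩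
      · rintro ⟨⟨hab, hcb⟩, htb⟩
        exact ⟨⟨hab.trans hcb.symm, hab⟩, fun hta => htb (hta.trans hab), fun htc => htb (htc.trans hcb)⟩
    rw [e1] at Md
    rw [e2] at Mc
    rw [mc_set_eq w a t c b, mK_set_eq w a t c b]
    linarith

end KNGoodThreeKN

end Summit.CriticalPhenomena.PercolationContinuityZ3.Theorems
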